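import Literature.NumberTheory.Sieve.CFSemigroupCongruenceNormCount
import HarnessLib

/-!
# The main term of the Magee–Oh–Winter uniform counting theorem

For a finite alphabet `A ⊂ ℕ` of size at least two, with continued-fraction semigroup `Γ_A` and
`δ_A = dim_H Λ_A`, [MageeOhWinter2019, Thm. 1] states: there are `Q₀ ≥ 1`, `c > 0`, `C`, `ε > 0` such that
for every `q` prime to `Q₀` and every `ξ ∈ SL₂(ℤ/qℤ)`,
`#{γ ∈ Γ_A : ‖γ‖ ≤ R, γ ≡ ξ (q)} = c R^{2δ_A} / #SL₂(ℤ/qℤ) + O(q^C R^{2δ_A - ε})`.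
This is the named fact `MageeOhWinter2019_uniformCounting` of `CFSemigroupCounting`.

This file assembles, in the vocabulary of that fact (`cfCount`, `cfDimension`), everything of it that the
thermodynamic/renewal development `CFSemigroup*.lean` proves WITHOUT the expansion input
[MageeOhWinter2019, Thm. 4] and WITHOUT Dolgopyat's estimates: the positivity `δ_A > 0`, the modulus
`Q₀ = 6 (b - a)` for two letters `a < b` of `A` (so that `SL₂(ℤ/qℤ)` is perfect and the pair twists generate,
[MageeOhWinter2019, §2.2]), ONE constant `c > 0` (the `q = 1` asymptotic constant, independent of `q`), and
for every `q ≥ 1` prime to `Q₀` and every residue class `ξ` the asymptotic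
`cfCount A q ξ R ~ c R^{2δ_A} / #SL₂(ℤ/qℤ)`, equivalently
`|cfCount A q ξ R - c R^{2δ_A} / #SL₂(ℤ/qℤ)| = o(R^{2δ_A})` as `R → ∞` — the main term of
[MageeOhWinter2019, Thm. 1 and Thm. 11] with the error term `o(·)` in place of the uniform power saving
`O(q^C R^{2δ_A-ε})` (which is exactly what [MageeOhWinter2019, Thm. 4] adds).

## References
* [MageeOhWinter2019] M. Magee, H. Oh, D. Winter, *Uniform congruence counting for Schottky semigroups in
  SL₂(ℤ)*, J. reine angew. Math. 753 (2019), 89–135, Thm. 1, Thm. 11, §2.2.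
-/

open Set Filter Topology
open scoped MatrixGroups

namespace Literature.NumberTheory.Sieve

variable {A : Finset ℕ}

/-- **Main term of [MageeOhWinter2019, Thm. 1], all admissible levels at once:** for `A ⊂ ℕ_{≥1}` with
`#A ≥ 2` one has `δ_A > 0`, and there are `Q₀ ≥ 1` and ONE constant `c > 0` with
`#{γ ∈ Γ_A : ‖γ‖_F ≤ R} ~ c R^{2δ_A}` such that for every `q ≥ 1` prime to `Q₀` and every `ξ ∈ SL₂(ℤ/qℤ)`,
`#{γ ∈ Γ_A : ‖γ‖_F ≤ R, γ ≡ ξ (q)} ~ c R^{2δ_A} / #SL₂(ℤ/qℤ)` as `R → ∞`.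
(`Q₀ = 6 (b - a)` for letters `a < b`; the power saving of the fact `MageeOhWinter2019_uniformCounting`
is not asserted here.) [cite: MageeOhWinter2019, Thm. 1 and Thm. 11] -/
theorem MageeOhWinter2019_mainTerm (A : Finset ℕ) (hA : ∀ a ∈ A, 1 ≤ a) (h2 : 2 ≤ A.card) :
    0 < cfDimension A ∧ ∃ Q₀ : ℕ, 0 < Q₀ ∧ ∃ c : ℝ, 0 < c ∧
      Tendsto (fun R : ℝ => (cfCount A 1 1 R : ℝ) / R ^ (2 * cfDimension A)) atTop (𝓝 c) ∧
      ∀ q : ℕ, 0 < q → Nat.Coprime q Q₀ → ∀ ξ : SL(2, ZMod q),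
        Tendsto (fun R : ℝ => (cfCount A q ξ R : ℝ) / R ^ (2 * cfDimension A)) atTop
          (𝓝 (c / Nat.card (SL(2, ZMod q)))) := by
  obtain ⟨a, ha, b, hb, hab⟩ := exists_ne_of_two_le_card A h2
  refine ⟨cfDimension_pos hA h2, ?_⟩
  wlog hlt : a < b generalizing a b
  · exact this b hb a ha hab.symm (lt_of_le_of_ne (not_lt.1 hlt) hab.symm)
  refine ⟨6 * (b - a), by omega, ?_⟩
  -- the constant: the `q = 1` asymptotic constant
  obtain ⟨c, hc, hc1, -⟩ := cfCount_congr_tendsto hA h2 ha hb (q := 1) (Nat.coprime_one_left 6)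
    isCoprime_one_right
  refine ⟨c, hc, hc1, fun q hq hcop ξ => ?_⟩
  haveI : NeZero q := ⟨hq.ne'⟩
  have hq6 : Nat.Coprime q 6 := hcop.coprime_mul_right_right
  have hq' : IsCoprime ((b : ℤ) - a) q := by
    have h := (hcop.coprime_mul_left_right).symm.isCoprime
    rwa [Nat.cast_sub hlt.le] at h
  obtain ⟨c', -, hc1', hξ⟩ := cfCount_congr_tendsto hA h2 ha hb hq6 hq'
  rw [Nat.card_eq_fintype_card, ← tendsto_nhds_unique hc1' hc1]
  exact hξ ξ

/-- **The same in the shape of the fact `MageeOhWinter2019_uniformCounting`, with `o(R^{2δ_A})` in place of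
the uniform power saving:** `δ_A > 0` and there are `Q₀ ≥ 1`, `c > 0` such that for all `q ≥ 1` prime to
`Q₀` and all `ξ`, `|cfCount A q ξ R - c R^{2δ_A} / #SL₂(ℤ/qℤ)| / R^{2δ_A} → 0` as `R → ∞`.
[cite: MageeOhWinter2019, Thm. 1 and Thm. 11] -/
theorem MageeOhWinter2019_mainTerm' (A : Finset ℕ) (hA : ∀ a ∈ A, 1 ≤ a) (h2 : 2 ≤ A.card) :
    0 < cfDimension A ∧ ∃ Q₀ : ℕ, 0 < Q₀ ∧ ∃ c : ℝ, 0 < c ∧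
      ∀ q : ℕ, 0 < q → Nat.Coprime q Q₀ → ∀ ξ : SL(2, ZMod q),
        Tendsto (fun R : ℝ => |(cfCount A q ξ R : ℝ) - c * R ^ (2 * cfDimension A) /
          (Nat.card (SL(2, ZMod q)) : ℝ)| / R ^ (2 * cfDimension A)) atTop (𝓝 0) := by
  obtain ⟨hδ, Q₀, hQ₀, c, hc, -, h⟩ := MageeOhWinter2019_mainTerm A hA h2
  refine ⟨hδ, Q₀, hQ₀, c, hc, fun q hq hcop ξ => ?_⟩
  have h1 := ((h q hq hcop ξ).sub_const (c / Nat.card (SL(2, ZMod q)))).abs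
  rw [sub_self, abs_zero] at h1
  refine h1.congr' ?_
  filter_upwards [eventually_gt_atTop 0] with R hR
  have hRp : 0 < R ^ (2 * cfDimension A) := Real.rpow_pos_of_pos hR _
  rw [← abs_of_pos hRp, ← abs_div, abs_of_pos hRp, sub_div, div_right_comm (c * _),
    mul_div_cancel_right₀ _ hRp.ne']

end Literature.NumberTheory.Sieve
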